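import Literature.AlgebraicGeometry.Resolution.LogRegularEquivariantCharts
import Literature.AlgebraicGeometry.Resolution.StalkIdealLemmas
import Literature.AlgebraicGeometry.Resolution.BlowupPrincipalCharts
import Literature.AlgebraicGeometry.Motives.ProjectiveDescentNormProofs
import HarnessLib

/-!
# Equivariant Kato 1994 (10.4), scheme step: a STABLE resolving ideal sheaf, and projectivity
# of the blowing up (finite subsets in affine opens)

Topic: `Literature/AlgebraicGeometry/Resolution`. Second half of the discharge of the named fact
`IllusieTemkin2014_equivariantLogRegularResolution` (equivariant resolution of log regular
schemes: Illusie–Temkin, ILO 2014 Exp. VIII 3.4.9; Kato 1994 (10.4); Nizioł 2006 Thm. 5.10).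
Given a log regular Zariski fs atlas `ℬ` on `X` and a finite family `σ` of automorphisms of `X`
respecting its stalk monoids and closed under composition, the chart monomials `s_i` of
`LogRegularAtlas.exists_compatible_regular_charts_translate` (constant along the translates)
generate chart ideals `((σ k)^* φ_i (s_i)) ⊆ Γ(X, (σ k)⁻¹U_i)` on the translated atlas which glue
to ONE quasi-coherent ideal sheaf `J` (`exists_idealSheafData_ideal_eq_map_of_compatible`); the
blowing up of `X` along `J` is a resolution of singularities
(`IsBlowup.isResolution_of_blowupAlgebra_cover`), and `J` is STABLE under every `σ k`:
`J.comap (σ k) = J` — checked on stalks (`ext_of_forall_stalkIdeal_eq`,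
`stalkIdeal_comap_eq_map_stalkMap`): the stalk isomorphism `(σ k)_y^*` carries the generators
`((σ k')^* φ_j(s_j))_{σ k y}` to the generators `((σ k'')^* φ_j(s_j))_y` of the translate
`σ k'' = σ k' ∘ σ k`, which generate `J_y` by the compatibility of the translated charts. So the
automorphisms lift to the blowing up (`IsBlowup.liftAction`, `BlowupsEquivariant.lean`; done in
`LogRegularEquivariantResolutionHolds.lean`). Finally, blowing ups are projective in the sense the
consumers use: if finite subsets of `X` lie in affine opens then so do finite subsets of any
blowing up `X' → X` (the part over an affine `V` is `Proj` of the Rees algebra,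
`IsBlowup.exists_chartImmersion`; graded prime avoidance, `GradedPrimeAvoidance.exists_form_basicOpen`;
Liu, Prop. 3.3.36 (b)).

* `LogRegularAtlas.span_translateφ_map_germ` — the stalks of the chart ideals
  `((σ k)^* φ_i (s_i))` of the translated atlas;
* `LogRegularAtlas.stalkMap_germ_translateφ` — `(σ k)_y^* (((σ k')^*φ_j p)_{σ k y}) = ((σ k'')^*φ_j p)_y`
  for `σ k'' = σ k ≫ σ k'`;
* `LogRegularAtlas.exists_stable_resolution` — **a `σ`-stable ideal sheaf whose blowing up
  resolves `X`**;
* `IsBlowup.exists_isAffineOpen_finset_subset` — **finite subsets of a blowing up lie in affine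
  opens if those of the base do.**

References: [Kato1994] (10.3), (10.4); [Niziol2006] Prop. 4.3, Thm. 5.8, Thm. 5.10 (proof);
[IllusieTemkin2014ExpVIII] 3.4.9; [GortzWedhorn2020] Prop. 13.91, 13.92, (13.19); [Liu2002]
Prop. 3.3.36 (b); [Singh2011] 2.9.2 (graded prime avoidance).
-/

noncomputable section

open AlgebraicGeometry CategoryTheory TopologicalSpace Opposite
open scoped Pointwise

namespace Literature.AlgebraicGeometry.Resolution

universe u

/-! ## Finite subsets of a blowing up lie in affine opens -/

section Projective

variable {X' X : Scheme.{u}} {π : X' ⟶ X} {J : X.IdealSheafData}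

/-- **Finite subsets of a blowing up lie in affine opens if those of the base do** (the blowing up
is projective over the base: Liu, Prop. 3.3.36 (b); Görtz–Wedhorn I, Prop. 13.92 with (13.19)).
For a blowing up `π : X' → X` (universal property `IsBlowup`) and a finite `S ⊆ X'`: `π(S)` lies in
an affine open `V`, the part of `X'` over `V` is the open image of `Bl_{J(V)}(Spec Γ(X, V)) =
Proj Γ(X,V)[J(V)t]` (`IsBlowup.exists_chartImmersion`), and graded prime avoidance
(`GradedPrimeAvoidance.exists_form_basicOpen`) gives a form `F` of positive degree with the
preimage points of `S` in the affine open `D₊(F)`, whose image in `X'` is the required affine open.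
[cite: Liu2002, Prop. 3.3.36 (b)] [cite: GortzWedhorn2020, Prop. 13.92 and (13.19) p. 415] -/
theorem IsBlowup.exists_isAffineOpen_finset_subset (hπ : IsBlowup π J)
    (hX : ∀ S : Finset X, ∃ U : X.Opens, IsAffineOpen U ∧ (↑S : Set X) ⊆ U) (S : Finset X') :
    ∃ U : X'.Opens, IsAffineOpen U ∧ (↑S : Set X') ⊆ U := by
  classical
  obtain ⟨V, hV, hSV⟩ := hX (S.image π.base)
  obtain ⟨φ, hφo, -, hrange⟩ := hπ.exists_chartImmersion ⟨V, hV⟩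
  -- every point of `S` is in the image of the chart immersion
  have hS : ∀ x ∈ S, ∃ t : affineBlowup (J.ideal ⟨V, hV⟩), φ.base t = x := by
    intro x hx
    have hx' : x ∈ φ.opensRange := by
      rw [hrange]
      exact hSV (Finset.mem_coe.2 (Finset.mem_image_of_mem _ hx))
    exact hx'
  choose t ht using hS
  let T : Finset (affineBlowup (J.ideal ⟨V, hV⟩)) := S.attach.image fun x => t x.1 x.2
  obtain ⟨n, F, hn, hF, hT, -⟩ := Motives.GradedPrimeAvoidance.exists_form_basicOpen
    (reesGrading (J.ideal ⟨V, hV⟩)) (𝟙 (affineBlowup (J.ideal ⟨V, hV⟩))) Function.injective_id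
    IsClosedMap.id T ⊤ (fun _ _ => trivial)
  refine ⟨φ ''ᵁ Proj.basicOpen (reesGrading (J.ideal ⟨V, hV⟩)) F,
    (Proj.isAffineOpen_basicOpen _ F hF hn).image_of_isOpenImmersion φ, fun x hx => ?_⟩
  have hx : x ∈ S := Finset.mem_coe.1 hx
  refine ⟨t x hx, ?_, ht x hx⟩
  have hmem : t x hx ∈ T := Finset.mem_image.2 ⟨⟨x, hx⟩, Finset.mem_attach _ _, rfl⟩
  simpa using hT _ hmem

/-- The same for the chosen blowing up `blowup J` of the tree. [cite: Liu2002, Prop. 3.3.36 (b)] -/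
theorem blowup.exists_isAffineOpen_finset_subset (J : X.IdealSheafData)
    (hX : ∀ S : Finset X, ∃ U : X.Opens, IsAffineOpen U ∧ (↑S : Set X) ⊆ U)
    (S : Finset (blowup J)) : ∃ U : (blowup J).Opens, IsAffineOpen U ∧ (↑S : Set (blowup J)) ⊆ U :=
  (blowup.isBlowup J).exists_isAffineOpen_finset_subset hX S

end Projective

/-! ## Germs along equal morphisms -/

section Germs

variable {X Y : Scheme.{u}}

/-- Stalk maps of equal morphisms agree on germs (transport along `f = g` of the dependent type
of `stalkMap`). [folklore] -/
private theorem stalkMap_germ_congr {f g : X ⟶ Y} (hfg : f = g) (U : Y.Opens) (x : X)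
    (hx : f.base x ∈ U) (hx' : g.base x ∈ U) (s : Γ(Y, U)) :
    (f.stalkMap x).hom (Y.presheaf.germ U (f.base x) hx s) =
      (g.stalkMap x).hom (Y.presheaf.germ U (g.base x) hx' s) := by
  subst hfg
  rfl

end Germs

/-! ## The chart ideals of the translated atlas -/

namespace LogRegularAtlas

variable {X : Scheme.{u}} (ℬ : LogRegularAtlas X) {κ : Type} (σ : κ → Aut X)
  (hσ : ∀ k, ℬ.RespectsStalkMonoids (σ k))

/-- The stalk at `y` of a translated chart ideal is generated by the germs of its monomials.
[cite: Kato1994, (10.4)] -/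
theorem span_translateφ_map_germ (s : ∀ i : ℬ.ι, Finset (ℬ.P i)) (ik : ℬ.ι × κ) (y : X)
    (hy : y ∈ (ℬ.translateU σ ik : X.Opens)) :
    (Ideal.span ((fun p : ℬ.P ik.1 => ℬ.translateφ σ ik (Multiplicative.ofAdd p)) ''
        (s ik.1 : Set (ℬ.P ik.1)))).map (X.presheaf.germ (ℬ.translateU σ ik : X.Opens) y hy).hom =
      Ideal.span ((fun p : ℬ.P ik.1 =>
        (X.presheaf.germ (ℬ.translateU σ ik : X.Opens) y hy).hom
          (ℬ.translateφ σ ik (Multiplicative.ofAdd p))) '' (s ik.1 : Set (ℬ.P ik.1))) := by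
  rw [Ideal.map_span, ← Set.image_comp]
  rfl

/-- **Translating generators.** If `σ k'' = σ k ≫ σ k'` (as morphisms), then for `y` with
`σ k y ∈ (σ k')⁻¹ U_j` the stalk isomorphism `(σ k)_y^*` carries the germ at `σ k y` of
`(σ k')^* φ_j(p)` to the germ at `y` of `(σ k'')^* φ_j(p)`. [cite: Kato1994, (1.5)–(1.6)] -/
theorem stalkMap_germ_translateφ {k k' k'' : κ} (hk : (σ k'').hom = (σ k).hom ≫ (σ k').hom)
    (j : ℬ.ι) (y : X) (hy' : (σ k).hom.base y ∈ (ℬ.translateU σ (j, k') : X.Opens))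
    (hy'' : y ∈ (ℬ.translateU σ (j, k'') : X.Opens)) (p : Multiplicative (ℬ.P j)) :
    ((σ k).hom.stalkMap y).hom
        ((X.presheaf.germ (ℬ.translateU σ (j, k') : X.Opens) ((σ k).hom.base y) hy').hom
          (ℬ.translateφ σ (j, k') p)) =
      (X.presheaf.germ (ℬ.translateU σ (j, k'') : X.Opens) y hy'').hom (ℬ.translateφ σ (j, k'') p) := by
  rw [ℬ.germ_translateφ σ (j, k') _ hy' p, ℬ.germ_translateφ σ (j, k'') y hy'' p]
  change (((σ k').hom.stalkMap ((σ k).hom.base y)) ≫ (σ k).hom.stalkMap y).hom _ = _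
  rw [← Scheme.Hom.stalkMap_comp]
  exact stalkMap_germ_congr hk.symm (ℬ.U j : X.Opens) y hy' hy'' (ℬ.φ j p)

/-- The translated stalk ideal: `(σ k)_y^*` carries the stalk at `σ k y` of the chart ideal of
`(j, k')` onto the stalk at `y` of the chart ideal of `(j, k'')`, `σ k'' = σ k ≫ σ k'`.
[cite: Kato1994, (10.4)] -/
theorem map_stalkMap_span_translateφ_map_germ (s : ∀ i : ℬ.ι, Finset (ℬ.P i)) {k k' k'' : κ}
    (hk : (σ k'').hom = (σ k).hom ≫ (σ k').hom) (j : ℬ.ι) (y : X)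
    (hy' : (σ k).hom.base y ∈ (ℬ.translateU σ (j, k') : X.Opens))
    (hy'' : y ∈ (ℬ.translateU σ (j, k'') : X.Opens)) :
    ((Ideal.span ((fun p : ℬ.P j => ℬ.translateφ σ (j, k') (Multiplicative.ofAdd p)) ''
        (s j : Set (ℬ.P j)))).map
        (X.presheaf.germ (ℬ.translateU σ (j, k') : X.Opens) ((σ k).hom.base y) hy').hom).map
        ((σ k).hom.stalkMap y).hom =
      (Ideal.span ((fun p : ℬ.P j => ℬ.translateφ σ (j, k'') (Multiplicative.ofAdd p)) ''
        (s j : Set (ℬ.P j)))).map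
        (X.presheaf.germ (ℬ.translateU σ (j, k'') : X.Opens) y hy'').hom := by
  rw [ℬ.span_translateφ_map_germ σ s (j, k'), ℬ.span_translateφ_map_germ σ s (j, k''),
    Ideal.map_span, ← Set.image_comp]
  congr 1
  refine Set.image_congr fun p _ => ?_
  exact ℬ.stalkMap_germ_translateφ σ hk j y hy' hy'' (Multiplicative.ofAdd p)

/-! ## A stable resolving ideal sheaf -/

variable [Finite κ] [Nonempty κ]

include hσ in
/-- **Equivariant Kato (10.4), scheme step.** For a log regular atlas `ℬ` and a finite nonempty
family `σ` of automorphisms of `X` respecting its stalk monoids and CLOSED UNDER COMPOSITION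
(`∀ k k', ∃ k'', σ k'' = σ k ≫ σ k'`), there is a quasi-coherent ideal sheaf `J` on `X` such that
(i) `J` is stable under every `σ k` (`J.comap (σ k) = J`), and (ii) the blowing up of `X` along `J`
is a resolution of singularities (proper, birational, regular source). `J` is glued from the
chart ideals `((σ k)^* φ_i (s_i))` of the translated atlas, the `s_i` being the monomials of
`exists_compatible_regular_charts_translate` (compatible on overlaps, regular blow-up charts,
constant along the translates); stability is checked on stalks. [cite: Kato1994, (10.4)]
[cite: Niziol2006, Thm. 5.8 and Thm. 5.10 (proof)] [cite: IllusieTemkin2014ExpVIII, 3.4.9] -/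
theorem exists_stable_resolution (hcl : ∀ k k' : κ, ∃ k'', (σ k'').hom = (σ k).hom ≫ (σ k').hom) :
    ∃ J : X.IdealSheafData, (∀ k, J.comap (σ k).hom = J) ∧ IsResolution (blowup.π J) := by
  classical
  obtain ⟨s, hsne, hcompat, hreg⟩ := ℬ.exists_compatible_regular_charts_translate σ hσ
  -- the chart ideals and their gluing
  let I : ∀ ik : ℬ.ι × κ, Ideal Γ(X, ((ℬ.translate σ hσ).U ik : X.Opens)) := fun ik =>
    Ideal.span ((fun p : ℬ.P ik.1 => (ℬ.translate σ hσ).φ ik (Multiplicative.ofAdd p)) ''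
      (s ik.1 : Set (ℬ.P ik.1)))
  have hU' : ∀ y : X, ∃ ik : ℬ.ι × κ, y ∈ ((ℬ.translate σ hσ).U ik : X.Opens) := fun y => by
    have hy : y ∈ ⨆ ik, ((ℬ.translate σ hσ).U ik : X.Opens) := by
      rw [(ℬ.translate σ hσ).iSup_eq_top]; trivial
    exact Opens.mem_iSup.mp hy
  obtain ⟨J, hJ⟩ := exists_idealSheafData_ideal_eq_map_of_compatible (ℬ.translate σ hσ).U hU' I
    (fun i j W hi hj => map_eq_map_of_forall_map_germ_eq W hi hj (I i) (I j)
      fun y hy => hcompat i j y (hi hy) (hj hy))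
  have hJU : ∀ ik, J.ideal ((ℬ.translate σ hσ).U ik) = I ik := fun ik => by
    rw [hJ ik _ le_rfl, map_presheaf_map_homOfLE_refl]
  have hJy : ∀ (ik : ℬ.ι × κ) (y : X) (hy : y ∈ ((ℬ.translate σ hσ).U ik : X.Opens)),
      stalkIdeal J y = (I ik).map (X.presheaf.germ ((ℬ.translate σ hσ).U ik : X.Opens) y hy).hom :=
    fun ik y hy => by rw [stalkIdeal_eq_map_germ J ((ℬ.translate σ hσ).U ik) hy, hJU]
  refine ⟨J, fun k => ?_, ?_⟩
  · -- (i) stability, on stalks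
    apply ext_of_forall_stalkIdeal_eq
    intro y
    rw [stalkIdeal_comap_eq_map_stalkMap]
    obtain ⟨⟨i, k₀⟩, hi⟩ := hU' y
    obtain ⟨⟨j, k'⟩, hj⟩ := hU' ((σ k).hom.base y)
    obtain ⟨k'', hk''⟩ := hcl k k'
    have hj'' : y ∈ ((ℬ.translate σ hσ).U (j, k'') : X.Opens) := by
      change (σ k'').hom.base y ∈ (ℬ.U j : X.Opens)
      rw [hk'']
      exact hj
    rw [hJy (j, k') _ hj, hJy (i, k₀) y hi, ℬ.map_stalkMap_span_translateφ_map_germ σ s hk'' j y hj hj'']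
    exact hcompat (j, k'') (i, k₀) y hj'' hi
  · -- (ii) the blowing up along `J` is a resolution
    haveI : ∀ ik, IsNoetherianRing Γ(X, ((ℬ.translate σ hσ).U ik : X.Opens)) :=
      (ℬ.translate σ hσ).isNoetherianRing
    choose a₀ ha₀ using hsne
    have hreg' : ∀ (ik : ℬ.ι × κ) (a : ↥(s ik.1))
        (𝔓 : Ideal (blowupAlgebra (J.ideal ((ℬ.translate σ hσ).U ik))
          ((ℬ.translate σ hσ).φ ik (Multiplicative.ofAdd (a : ℬ.P ik.1))))) [𝔓.IsPrime],
        IsRegularLocalRing (Localization.AtPrime 𝔓) := by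
      intro ik
      rw [hJU ik]
      intro a 𝔓 h𝔓
      exact @hreg ik a a.2 𝔓 h𝔓
    refine (blowup.isBlowup J).isResolution_of_blowupAlgebra_cover (ℬ.translate σ hσ).U
      (ℬ.translate σ hσ).iSup_eq_top (κ := fun ik => ↥(s ik.1))
      (fun ik a => (ℬ.translate σ hσ).φ ik (Multiplicative.ofAdd (a : ℬ.P ik.1)))
      (fun ik a => ?_) (fun ik => ?_)
      (fun ik => (ℬ.translate σ hσ).φ ik (Multiplicative.ofAdd (a₀ ik.1)))
      (fun ik => ?_)
      (fun ik => LogChart.map_mem_nonZeroDivisors_of_forall_isLogRegularAt ((ℬ.translate σ hσ).fg ik)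
        ((ℬ.translate σ hσ).saturated ik) (fun 𝔭 _ => (ℬ.translate σ hσ).isLogRegularAt ik 𝔭) (a₀ ik.1))
      hreg'
    · rw [hJU]
      exact Ideal.subset_span ⟨a, a.2, rfl⟩
    · rw [hJU]
      refine Ideal.span_le.2 ?_
      rintro _ ⟨p, hp, rfl⟩
      exact Ideal.subset_span ⟨⟨p, hp⟩, rfl⟩
    · rw [hJU]
      exact Ideal.subset_span ⟨a₀ ik.1, ha₀ ik.1, rfl⟩

end LogRegularAtlas

end Literature.AlgebraicGeometry.Resolution

end
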